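import Summits.ResolutionOfSingularities.ResolutionOfSingularities.Theorems.FrobeniusClosingSteerMemberDerivationFrameEngine
import Literature.AlgebraicGeometry.Resolution.SmoothOfRegularFibre
import HarnessLib

/-!
# Crux `Steer` (stmt-ResolutionOfSingularities-16345), chain W4.1, hA3 Θ1♭ piece (L7), brick **(L7-Ω)**, part 2 of 3:
# the frame `dx ∪ du` is a BASIS of `Ω_{S/k}`, and `k`-derivations are determined on the frame

OURS (campaign `res-hironaka`, rung L ★L-G4, slot W4.1; seat res-L0-w41-stub-4 g6 on res-D-pv-004 (AS res-L0-w41-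
stub-10)'s split 2026-08-27T10:43:42Z «you take brick (L7-Ω) = step (a)»; replaces the role of no printed item; NOT a
statement of the manuscript under review [claim: Hironaka2017, status: under-review]; AI-produced, weaker than expert
review). Theses-free and definition-free. Part 1 is the engine `FrobeniusClosingSteerMemberDerivationFrameEngine.lean`
(split injectivity of `e_l ↦ d(x,u)_l`), part 3 `FrobeniusClosingSteerMemberDerivationFrame.lean` the frame itself.

## Contents

* §3a SPANNING (no smoothness needed): `span_D_eq_top_of_closure_eq_top` — if `K = K^p(z)` then `Ω_{K/k} = Σ K dz_j`;
  `span_tmul_D_eq_top` — if `(x) = 𝔪` and the `dū_j` span `Ω_{K/k}` (`K` the residue field of the local `k`-algebra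
  `A`) then `{1 ⊗ dx_i} ∪ {1 ⊗ du_j}` spans the fibre `K ⊗_A Ω_{A/k}`, by the conormal exact sequence
  `K ⊗ 𝔪 → K ⊗_A Ω_{A/k} → Ω_{K/k} → 0` (Mathlib `KaehlerDifferential.exact_kerCotangentToTensor_mapBaseChange`) and
  Leibniz (`1 ⊗ dm ∈ Σ K (1 ⊗ dx_i)` for `m ∈ 𝔪`).
* §3b BASIS + UNIQUENESS (engine hypotheses: `A` local, essentially of finite type and formally smooth over `k` with
  formally smooth residue field; `x` minimal generators of `𝔪`; residues of `u` with dual `k`-derivations AND spanning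
  differentials): `exists_basis` — `(dx_i) ∪ (du_j)` is a `Module.Basis (ι ⊕ ι') A Ω[A⁄k]` (independent by the
  engine's retraction, spanning by Nakayama from the fibre, `IsLocalRing.span_eq_top_of_tmul_eq_basis`);
  `derivation_eq_of_apply_eq` — two `k`-derivations of `A` into ANY `A`-module agreeing on the `x_i` and the `u_j`
  are equal.
* §3b′ for `S` REGULAR local essentially of finite type over a PERFECT field of characteristic `p` (formally smooth by
  the tree's `formallySmooth_of_isRegularLocalRing_of_perfectField`, Stacks 00TV) and `u` lifting a `p`-basis of the
  residue field: `exists_kaehler_basis` (`Ω_{S/k}` is free on the frame, rank `dim S + p-rank κ`) and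
  `derivation_eq_of_apply_eq_frame` (UNIQUENESS on the frame, e.g. for identifying continuous extensions to `Ŝ` —
  step (c) of res-D-pv-004's (L7) plan).

[cite: Matsumura1987, §30 Thm. 30.6 p. 240; §26 Thm. 26.5; §25 Thm. 25.2] [cite: StacksProject, Tag 00TV] [folklore]
bears_on: LADDER-RESOLUTION L ★L-G4 W4.1 (crux `Steer`, hA3 (L7)).
-/

noncomputable section

-- `Summit.<S>.<S>.…` duplicates the summit name by design (single-problem summit).
set_option linter.dupNamespace false

open IsLocalRing TensorProduct KaehlerDifferential

namespace Summit.ResolutionOfSingularities.ResolutionOfSingularities.Theorems.SwitchingDichotomy.MemberDerivationFrame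

open Literature.AlgebraicGeometry.Resolution Literature.FieldTheory.Separability

universe u v w w'

/-! ## §3a Spanning: `Ω_{K/k} = Σ K dz_j` for a `p`-basis, and the fibre of `Ω_{A/k}` -/

section Span

/-- **The differentials of a `p`-basis span**: if `K = K^p(z)` (as a subfield closure) and `char K = p`, then
`Ω_{K/k}` is spanned by the `dz_j` (`d(y^p) = 0`, and `d` of sums, products, inverses stays in the span).
[cite: Matsumura1987, Thm. 26.5] [folklore] -/
theorem span_D_eq_top_of_closure_eq_top (p : ℕ) {k : Type u} {K : Type v} [Field k] [Field K] [Algebra k K]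
    [CharP K p] {ι' : Type w'} (z : ι' → K)
    (hz : Subfield.closure (Set.range (fun y : K => y ^ p) ∪ Set.range z) = ⊤) :
    Submodule.span K (Set.range fun j => D k K (z j)) = ⊤ := by
  set N := Submodule.span K (Set.range fun j => D k K (z j))
  have key : ∀ c : K, D k K c ∈ N := by
    intro c
    have hc : c ∈ Subfield.closure (Set.range (fun y : K => y ^ p) ∪ Set.range z) := by
      rw [hz]; trivial
    refine Subfield.closure_induction (p := fun c _ => D k K c ∈ N) ?_ ?_ ?_ ?_ ?_ ?_ hc
    · rintro c (⟨y, rfl⟩ | ⟨j, rfl⟩)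
      · have h0 : D k K (y ^ p) = 0 := by
          rw [Derivation.leibniz_pow, ← Nat.cast_smul_eq_nsmul K, CharP.cast_eq_zero, zero_smul]
        change D k K (y ^ p) ∈ N
        rw [h0]; exact zero_mem N
      · exact Submodule.subset_span ⟨j, rfl⟩
    · rw [Derivation.map_one_eq_zero]; exact zero_mem N
    · intro a b _ _ ha hb
      rw [map_add]; exact add_mem ha hb
    · intro a _ ha
      rw [map_neg]; exact neg_mem ha
    · intro a _ ha
      rw [Derivation.leibniz_inv]; exact N.smul_mem _ ha
    · intro a b _ _ ha hb
      rw [Derivation.leibniz]; exact add_mem (N.smul_mem _ hb) (N.smul_mem _ ha)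
  rw [eq_top_iff, ← KaehlerDifferential.span_range_derivation, Submodule.span_le]
  rintro _ ⟨c, rfl⟩
  exact key c

variable {k : Type u} {A : Type v} [Field k] [CommRing A] [IsLocalRing A] [Algebra k A]

/-- **The fibre of `Ω_{A/k}` is spanned by `{1 ⊗ dx_i} ∪ {1 ⊗ du_j}`** when `(x) = 𝔪` and the `dū_j` span `Ω_{K/k}`
(`K` the residue field): the conormal sequence `K ⊗ 𝔪 → K ⊗_A Ω_{A/k} → Ω_{K/k} → 0` is exact (Mathlib), and
`1 ⊗ dm ∈ Σ K (1 ⊗ dx_i)` for `m ∈ 𝔪` by Leibniz. No smoothness or finiteness is needed. [folklore] -/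
theorem span_tmul_D_eq_top {ι : Type w} {ι' : Type w'} (x : ι → A)
    (hx : Ideal.span (Set.range x) = maximalIdeal A) (u : ι' → A)
    (hspan : Submodule.span (ResidueField A)
      (Set.range fun j => D k (ResidueField A) (residue A (u j))) = ⊤) :
    Submodule.span (ResidueField A)
      (Set.range fun l => (1 : ResidueField A) ⊗ₜ[A] D k A (Sum.elim x u l)) = ⊤ := by
  classical
  set K := ResidueField A
  set W := Submodule.span K (Set.range fun l => (1 : K) ⊗ₜ[A] D k A (Sum.elim x u l))
  have hWx : ∀ i, (1 : K) ⊗ₜ[A] D k A (x i) ∈ W := fun i => Submodule.subset_span ⟨Sum.inl i, rfl⟩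
  have hWu : ∀ j, (1 : K) ⊗ₜ[A] D k A (u j) ∈ W := fun j => Submodule.subset_span ⟨Sum.inr j, rfl⟩
  -- (1) `1 ⊗ dm ∈ W` for `m ∈ 𝔪`
  have hm : ∀ m ∈ maximalIdeal A, (1 : K) ⊗ₜ[A] D k A m ∈ W := by
    intro m hm
    rw [← hx] at hm
    refine Submodule.span_induction ?_ ?_ ?_ ?_ hm
    · rintro _ ⟨i, rfl⟩; exact hWx i
    · rw [map_zero, tmul_zero]; exact zero_mem W
    · intro a b _ _ ha hb
      rw [map_add, tmul_add]; exact add_mem ha hb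
    · intro a m hm' hPm
      rw [smul_eq_mul, Derivation.leibniz, tmul_add, tmul_smul, tmul_smul]
      refine add_mem ?_ ?_
      · rw [← algebraMap_smul K a]; exact W.smul_mem _ hPm
      · rw [smul_tmul', Algebra.smul_def m (1 : K), mul_one, ResidueField.algebraMap_eq,
          (residue_eq_zero_iff m).mpr (hx.le hm'), zero_tmul]
        exact zero_mem W
  -- (2) `1 ⊗ ω ∈ W` for every `ω`, by exactness of the conormal sequence at `K ⊗ Ω_{A/k}`
  let β : K ⊗[A] Ω[A⁄k] →ₗ[K] Ω[K⁄k] := KaehlerDifferential.mapBaseChange k A K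
  have hsurj : Function.Surjective (algebraMap A K) := by
    rw [ResidueField.algebraMap_eq]; exact residue_surjective
  have h1 : ∀ ω : Ω[A⁄k], (1 : K) ⊗ₜ[A] ω ∈ W := by
    intro ω
    have hβtop : Submodule.map β W = ⊤ := by
      rw [eq_top_iff, ← hspan, Submodule.span_le]
      rintro _ ⟨j, rfl⟩
      refine ⟨_, hWu j, ?_⟩
      change KaehlerDifferential.mapBaseChange k A K ((1 : K) ⊗ₜ[A] D k A (u j)) = _
      rw [KaehlerDifferential.mapBaseChange_tmul, one_smul, KaehlerDifferential.map_D,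
        ResidueField.algebraMap_eq]
    obtain ⟨y, hyW, hy⟩ : ∃ y ∈ W, β y = β ((1 : K) ⊗ₜ[A] ω) := by
      have h : β ((1 : K) ⊗ₜ[A] ω) ∈ Submodule.map β W := by rw [hβtop]; trivial
      exact Submodule.mem_map.mp h
    have hker : β ((1 : K) ⊗ₜ[A] ω - y) = 0 := by rw [map_sub, hy, sub_self]
    obtain ⟨t, ht⟩ :=
      ((KaehlerDifferential.exact_kerCotangentToTensor_mapBaseChange k A K hsurj) _).mp hker
    obtain ⟨m, rfl⟩ := Ideal.toCotangent_surjective _ t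
    rw [KaehlerDifferential.kerCotangentToTensor_toCotangent] at ht
    have hmm : (m : A) ∈ maximalIdeal A := by rw [← IsLocalRing.ker_residue]; exact m.2
    have heq : (1 : K) ⊗ₜ[A] ω = y + ((1 : K) ⊗ₜ[A] ω - y) := (add_sub_cancel y _).symm
    rw [heq, ← ht]
    exact add_mem hyW (hm _ hmm)
  -- (3) pure tensors `κ ⊗ ω = κ • (1 ⊗ ω)` generate
  rw [eq_top_iff]
  rintro z -
  induction z using TensorProduct.induction_on with
  | zero => exact zero_mem W
  | tmul κ ω =>
    have h : κ ⊗ₜ[A] ω = κ • ((1 : K) ⊗ₜ[A] ω) := by rw [smul_tmul', smul_eq_mul, mul_one]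
    rw [h]; exact W.smul_mem κ (h1 ω)
  | add a b ha hb => exact add_mem ha hb

end Span

/-! ## §3b The frame is a basis of `Ω_{A/k}`; derivations are determined on the frame -/

section Basis

variable {k : Type u} {A : Type v} [Field k] [CommRing A] [IsLocalRing A] [Algebra k A]
  [Algebra.EssFiniteType k A] [Algebra.FormallySmooth k A] [Algebra.FormallySmooth k (ResidueField A)]

/-- **`dx ∪ du` IS A BASIS OF `Ω_{A/k}`.** Under the hypotheses of the engine (`A` local, essentially of finite type
and formally smooth over `k` with formally smooth residue field `K`; `x` minimal generators of `𝔪`; the residues of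
`u` carry dual `k`-derivations `δ` of `K`) and if moreover the `dū_j` SPAN `Ω_{K/k}` (e.g. `ū` a `p`-basis,
`span_D_eq_top_of_closure_eq_top`), the family `(dx_i)_i ∪ (du_j)_j` is a basis of the `A`-module `Ω_{A/k}`
(independent by the retraction `exists_retraction_sum`; spanning by Nakayama from the fibre, `span_tmul_D_eq_top` +
`IsLocalRing.span_eq_top_of_tmul_eq_basis`). [cite: Matsumura1987, Thm. 30.6] [folklore] -/
theorem exists_basis {ι : Type w} {ι' : Type w'} [Fintype ι] [DecidableEq ι] [Fintype ι'] [DecidableEq ι']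
    (x : ι → A) (hx : Ideal.span (Set.range x) = maximalIdeal A)
    (hcard : Fintype.card ι = (maximalIdeal A).spanFinrank) (u : ι' → A)
    (hspan : Submodule.span (ResidueField A)
      (Set.range fun j => D k (ResidueField A) (residue A (u j))) = ⊤)
    (δ : ι' → Derivation k (ResidueField A) (ResidueField A))
    (hδ : ∀ j j', δ j (residue A (u j')) = if j' = j then 1 else 0) :
    ∃ b : Module.Basis (ι ⊕ ι') A Ω[A⁄k], ∀ l, b l = D k A (Sum.elim x u l) := by
  classical
  set K := ResidueField A
  let v : ι ⊕ ι' → Ω[A⁄k] := fun l => D k A (Sum.elim x u l)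
  obtain ⟨ρ, hρ⟩ := exists_retraction_sum (k := k) x hx hcard u δ hδ
  have hρD : ∀ l, ρ (v l) = Pi.single l 1 := by
    intro l
    have h := LinearMap.congr_fun hρ (Pi.single l 1)
    rwa [LinearMap.comp_apply, Fintype.linearCombination_apply_single, one_smul, LinearMap.id_apply] at h
  -- independence over `A`
  have hli : LinearIndependent A v := by
    rw [linearIndependent_iff_injective_fintypeLinearCombination]
    intro a b hab
    have h := congrArg ρ hab
    have hρ' : ∀ y, ρ (Fintype.linearCombination A v y) = y := fun y => by
      have h' := LinearMap.congr_fun hρ y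
      rwa [LinearMap.comp_apply, LinearMap.id_apply] at h'
    rwa [hρ', hρ'] at h
  -- the fibre family is a basis of `K ⊗ Ω_{A/k}`
  have hliK : LinearIndependent K fun l => (1 : K) ⊗ₜ[A] v l := by
    let Φ : K ⊗[A] Ω[A⁄k] →ₗ[K] (ι ⊕ ι' → K) :=
      (TensorProduct.piScalarRight A K K (ι ⊕ ι')).toLinearMap ∘ₗ ρ.baseChange K
    refine LinearIndependent.of_comp Φ ?_
    have hΦ : (Φ ∘ fun l => (1 : K) ⊗ₜ[A] v l) = fun l => Pi.single l (1 : K) := by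
      funext l
      change TensorProduct.piScalarRight A K K (ι ⊕ ι') (ρ.baseChange K ((1 : K) ⊗ₜ[A] v l)) = _
      rw [LinearMap.baseChange_tmul, hρD, TensorProduct.piScalarRight_apply,
        TensorProduct.piScalarRightHom_tmul]
      funext l'
      by_cases h : l' = l
      · subst h
        rw [Pi.single_eq_same, Pi.single_eq_same, one_smul]
      · rw [Pi.single_eq_of_ne h, Pi.single_eq_of_ne h, zero_smul]
    rw [hΦ]
    exact Pi.linearIndependent_single_one (ι ⊕ ι') K
  have hspK := span_tmul_D_eq_top (k := k) x hx u hspan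
  let bK : Module.Basis (ι ⊕ ι') K (K ⊗[A] Ω[A⁄k]) := Module.Basis.mk hliK (by rw [hspK])
  -- Nakayama: `v` spans `Ω_{A/k}`
  have hsp : Submodule.span A (Set.range v) = ⊤ :=
    IsLocalRing.span_eq_top_of_tmul_eq_basis v bK fun l => by rw [Module.Basis.mk_apply]
  exact ⟨Module.Basis.mk hli (by rw [hsp]), fun l => by rw [Module.Basis.mk_apply]⟩

/-- **A `k`-derivation is determined by its values on the frame**: under the hypotheses of `exists_basis`, two
`k`-derivations of `A` into any `A`-module `M` that agree on the `x_i` and on the `u_j` are equal (`Ω_{A/k}` has the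
basis `dx ∪ du`, and derivations factor through `Ω_{A/k}`). [cite: Matsumura1987, Thm. 30.6] [folklore] -/
theorem derivation_eq_of_apply_eq {ι : Type w} {ι' : Type w'} [Fintype ι] [DecidableEq ι] [Fintype ι']
    [DecidableEq ι'] (x : ι → A) (hx : Ideal.span (Set.range x) = maximalIdeal A)
    (hcard : Fintype.card ι = (maximalIdeal A).spanFinrank) (u : ι' → A)
    (hspan : Submodule.span (ResidueField A)
      (Set.range fun j => D k (ResidueField A) (residue A (u j))) = ⊤)
    (δ : ι' → Derivation k (ResidueField A) (ResidueField A))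
    (hδ : ∀ j j', δ j (residue A (u j')) = if j' = j then 1 else 0)
    {M : Type*} [AddCommGroup M] [Module A M] [Module k M] [IsScalarTower k A M]
    (D₁ D₂ : Derivation k A M) (hDx : ∀ i, D₁ (x i) = D₂ (x i)) (hDu : ∀ j, D₁ (u j) = D₂ (u j)) :
    D₁ = D₂ := by
  obtain ⟨b, hb⟩ := exists_basis (k := k) x hx hcard u hspan δ hδ
  have h : D₁.liftKaehlerDifferential = D₂.liftKaehlerDifferential := by
    refine b.ext fun l => ?_
    rw [hb, Derivation.liftKaehlerDifferential_comp_D, Derivation.liftKaehlerDifferential_comp_D]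
    rcases l with i | j
    · exact hDx i
    · exact hDu j
  have h' := congrArg (fun f : Ω[A⁄k] →ₗ[A] M => f.compDer (D k A)) h
  simpa only [Derivation.liftKaehlerDifferential_comp] using h'

end Basis

/-! ## §3b′ Regular local rings essentially of finite type over a perfect field -/

section Regular

variable (p : ℕ)

/-- In characteristic `p`, a residue `p`-basis has spanning differentials: `Ω_{κ/k} = Σ κ dū_j`. [folklore] -/
theorem span_D_residue_eq_top {k S : Type u} [Field k] [CharP k p] [CommRing S] [IsLocalRing S] [Algebra k S]
    {e : ℕ} (u : Fin e → S)
    (hu : Subfield.closure (Set.range (fun y : ResidueField S => y ^ p) ∪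
      Set.range (fun j => residue S (u j))) = ⊤) :
    Submodule.span (ResidueField S)
      (Set.range fun j => D k (ResidueField S) (residue S (u j))) = ⊤ := by
  haveI : CharP (ResidueField S) p :=
    charP_of_injective_algebraMap (algebraMap k (ResidueField S)).injective p
  exact span_D_eq_top_of_closure_eq_top p _ hu

/-- **`Ω_{S/k}` IS FREE ON THE FRAME**: with `x, u, δ` as in `exists_dual_derivations` and the residues of `u` a
`p`-basis of `κ` (`κ = κ^p(ū)`), the family `dx_1, …, dx_c, du_1, …, du_e` is a basis of the `S`-module
`Ω_{S/k}` (so `Ω_{S/k}` is free of rank `c + e = dim S + p-rank κ`). [cite: Matsumura1987, Thm. 30.6]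
[cite: StacksProject, Tag 00TV] [folklore] -/
theorem exists_kaehler_basis (k S : Type u) [Field k] [CharP k p] [PerfectField k] [CommRing S]
    [IsRegularLocalRing S] [Algebra k S] [Algebra.EssFiniteType k S] {c e : ℕ}
    (hc : (maximalIdeal S).spanFinrank = c) (x : Fin c → S) (hx : Ideal.span (Set.range x) = maximalIdeal S)
    (u : Fin e → S)
    (hu : Subfield.closure (Set.range (fun y : ResidueField S => y ^ p) ∪
      Set.range (fun j => residue S (u j))) = ⊤)
    (δ : Fin e → Derivation k (ResidueField S) (ResidueField S))
    (hδ : ∀ j j', δ j (residue S (u j')) = if j' = j then 1 else 0) :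
    ∃ b : Module.Basis (Fin c ⊕ Fin e) S Ω[S⁄k], ∀ l, b l = D k S (Sum.elim x u l) := by
  haveI : Algebra.FormallySmooth k S := formallySmooth_of_isRegularLocalRing_of_perfectField k S
  haveI : Algebra.FormallySmooth k (ResidueField S) :=
    formallySmooth_residueField_of_perfectField (k := k) (A := S)
  exact exists_basis (k := k) x hx (by rw [Fintype.card_fin, hc]) u (span_D_residue_eq_top p u hu) δ hδ

/-- **UNIQUENESS ON THE FRAME**: with `x, u, δ` as in `exists_kaehler_basis`, two `k`-derivations of `S` into ANY
`S`-module `M` (e.g. `M = Ŝ`, the values of continuous extensions) that agree on every `x_i` and every `u_j` are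
equal. [cite: Matsumura1987, Thm. 30.6] [folklore] -/
theorem derivation_eq_of_apply_eq_frame (k S : Type u) [Field k] [CharP k p] [PerfectField k] [CommRing S]
    [IsRegularLocalRing S] [Algebra k S] [Algebra.EssFiniteType k S] {c e : ℕ}
    (hc : (maximalIdeal S).spanFinrank = c) (x : Fin c → S) (hx : Ideal.span (Set.range x) = maximalIdeal S)
    (u : Fin e → S)
    (hu : Subfield.closure (Set.range (fun y : ResidueField S => y ^ p) ∪
      Set.range (fun j => residue S (u j))) = ⊤)
    (δ : Fin e → Derivation k (ResidueField S) (ResidueField S))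
    (hδ : ∀ j j', δ j (residue S (u j')) = if j' = j then 1 else 0)
    {M : Type*} [AddCommGroup M] [Module S M] [Module k M] [IsScalarTower k S M]
    (D₁ D₂ : Derivation k S M) (hDx : ∀ i, D₁ (x i) = D₂ (x i)) (hDu : ∀ j, D₁ (u j) = D₂ (u j)) :
    D₁ = D₂ := by
  haveI : Algebra.FormallySmooth k S := formallySmooth_of_isRegularLocalRing_of_perfectField k S
  haveI : Algebra.FormallySmooth k (ResidueField S) :=
    formallySmooth_residueField_of_perfectField (k := k) (A := S)
  exact derivation_eq_of_apply_eq (k := k) x hx (by rw [Fintype.card_fin, hc]) u (span_D_residue_eq_top p u hu)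
    δ hδ D₁ D₂ hDx hDu

end Regular

end Summit.ResolutionOfSingularities.ResolutionOfSingularities.Theorems.SwitchingDichotomy.MemberDerivationFrame

end
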